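import Summits.ABC.IUTFork.Repair.CandInternal2RealHex
import Summits.ABC.IUTFork.Cor312GenuineKLocalTypeThirty
import HarnessLib

/-!
# IUT REPAIR BRANCH (rung LADDER-ABC:A2.RP → A2.RESCUE-H), class (i) INTERNAL — `CandInternal2RealHexThirty`: the «HEX-I06STAR-NEG FAMILY
# THEOREM» of abc-iut-rp-d2 (p456127) made MODEL-FREE from `k ≥ 2` by abc-iut-W-neg-1's cyclic-inertia local type `e(K_{x₀}/ℚ_7) ≤ 30·l`

PROOF-ONLY file (D-0012; 0 definitions, 0 `Prop` facts) of the abc-iut cell, IUT REPAIR branch / D-0079 RESCUE sub-cell R-H («local-height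
condition I06⋆», lead abc-iut-rh-lead g0; `plan/rescue/R-H/START-HERE.md` §8 A4 «certified NEG of record for I06⋆ on HEX»). Filed by
abc-iut-rh-typ-10 gen 2 (free capacity after ROUND 1 row 10) because the author seat of p456127, abc-iut-rp-d2 gen 3, is parked; the
mathematics is abc-iut-rp-d2's (p456127 `i06star_topLabel_false_A1`), abc-iut-W-neg-1's (`Cor312GenuineKLocalTypeThirty`) and abc-iut-c312-7's
(`GenuineK.exists_place_lamSeven`) — this file is their three-line composition. TAKES NO SIDE on [IUTchIII] Cor. 3.12 or on any author;
«refuted as typed at OUR genuine datum» ≠ «refuted in print»; typed ≠ proved; nothing here asserts abc.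

WHAT. p456127 proves the TOP-LABEL cell of RP-I06⋆ (`t_q(x₀) ∈ t_q(x₀)^{l⋆²}·ℐ_{K_{x₀}}`, real log-shell) FALSE at a bad place `x₀ | 7` of every
genuine Θ-volume datum at `(ratPoint λ_k, l)`, MODEL-FREE for `l = 11, k ≥ 6` / `l = 13, k ≥ 5` (print-side ramification bound
`e ≤ 46080·l(l−1)²(l+1)`), and for `k ≥ 2` only UNDER R-W's local-model input A1 `e(x₀) ≤ 30·l` taken as a hypothesis on the place
(`i06star_topLabel_false_A1`). Since then abc-iut-W-neg-1 LANDED `Conditional.GenuineK.absRamificationIdx_kOf_le_thirty_mul_lamSeven`: tame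
inertia is cyclic, so `e(K_{x₀}/ℚ_7) ∣ 30·l` at EVERY `x₀ | 7` (`k ≥ 1`, `l ≥ 11`) — A1 is a THEOREM at `λ_k`. Composing (§1):
**`i06star_topLabel_false_lamSeven_thirty`** — `l` prime, `11 ≤ l ≤ 68`, `16·l ≤ k·(l−3)(l+1)` ⟹ at abc-iut-c312-7's bad place `x₀ | 7`
(`‖t_q(x₀)‖ = 7^{−k/l}` for the CHOSEN realising q-idele) the top-label cell FAILS, with NO local-model input; rows **`…_l11_two`**, **`…_l13_two`**:
EVERY `k ≥ 2` at `l ∈ {11, 13}` — all 240 rows `k ≥ 2` of the lamSeven block of `plan/rescue/R-H/I06STAR-COLUMNS.tsv` are I06⋆-NEG at the top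
label BY ONE NAMED THEOREM (the 16 rows `k = 1` stay local-type dependent: decided by number). [cite: Mochizuki2012, IUTchI Def. 3.1 (b),(c) pp. 61–62,
Ex. 3.2 (iv) p. 71; IUTchIV Prop. 1.2 (i) p. 10, Cor. 2.2 (ii) proof (P5) p. 46] [cite: MochizukiAbsTopIII2015, Def 5.4 (iii) p. 126]
[cite: SerreLocalFields1979, Ch. IV §2 Cor. 1 of Prop. 7] [claim: Mochizuki2012, status: disputed] for every IUT sentence quoted. Axioms: standard.
-/

noncomputable section

open NumberField IsDedekindDomain

namespace Summit.ABC.IUTFork.Repair.CandInternal2RealHex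

open Set Metric
open scoped Pointwise
open Thm311 Thm311.Real Cor312 Cor312Prov Literature.IUT.LogVolume Literature.IUT.HodgeTheaters Literature.IUT.LogThetaLattice
  Literature.NumberTheory.NumberFields Literature.NumberTheory.DiophantineGeometry.GenEll Literature.NumberTheory.DiophantineGeometry
  Literature.AnabelianGeometry.AbsoluteAnabelian Summit.ABC.IUTFork.Conditional

/-! ## 1. The top-label negative at the genuine `λ_k` datum, model-free from `16·l ≤ k·(l−3)(l+1)` -/

/-- **HEX-I06STAR-NEG, MODEL-FREE FROM `k ≥ 2`.** `l` prime, `11 ≤ l ≤ 68`, `16·l ≤ k·(l−3)(l+1)`, `T` a genuine Θ-volume datum at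
`(ratPoint λ_k, l)`. Then at abc-iut-c312-7's bad place `x₀ | 7` of `T.K` the CHOSEN realising q-idele has `‖t_q(x₀)‖ = 7^{−k/l}` and
`t_q(x₀) ∉ t_q(x₀)^{l⋆²} · ℐ_{K_{x₀}}` — abc-iut-rp-d2's `i06star_topLabel_false_A1` with its place hypothesis `e(K_{x₀}/ℚ_7) ≤ 30·l` DISCHARGED by
abc-iut-W-neg-1's `GenuineK.absRamificationIdx_kOf_le_thirty_mul_lamSeven`. [cite: Mochizuki2012, IUTchIV Cor. 2.2 (ii) proof (P5) p. 46]
[cite: MochizukiAbsTopIII2015, Def 5.4 (iii) p. 126] [cite: SerreLocalFields1979, Ch. IV §2 Cor. 1 of Prop. 7] [claim: Mochizuki2012, status: disputed] -/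
theorem i06star_topLabel_false_lamSeven_thirty {k l : ℕ} (hl : l.Prime) (h11 : 11 ≤ l) (hl68 : l ≤ 68)
    (hk : 16 * l ≤ k * ((l - 3) * (l + 1))) (T : Cor22.ThetaVolumeDatumAt (ratPoint ((2 : ℚ)⁻¹ + 2 / 7 ^ k)) l) :
    letI := T.instFieldF; letI := T.instNumberFieldF; letI := T.instAlgebraF; letI := T.instFieldK
    letI := T.instNumberFieldK; letI := T.instAlgebraK; letI := T.instFieldFbar; letI := T.instAlgebraFbar
    letI := T.instAlgebraKFbar; letI := T.instIsElliptic
    haveI : Fact (Nat.Prime 7) := ⟨by norm_num⟩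
    ∃ x₀ : (thetaIndex (pilotDataOfK T.D T.K)).Fibre (.inr ⟨7, by norm_num⟩),
      placeOf (pilotDataOfK T.D T.K) 7 x₀ ∈ (pilotDataOfK T.D T.K).S ∧
      ‖(exists_realising_qIdeles_pilotDataOfK T.D).choose ⟨7, by norm_num⟩ x₀‖ = (7 : ℝ) ^ (-((k : ℝ) / l)) ∧
      (exists_realising_qIdeles_pilotDataOfK T.D).choose ⟨7, by norm_num⟩ x₀ ∉
        (exists_realising_qIdeles_pilotDataOfK T.D).choose ⟨7, by norm_num⟩ x₀ ^ (((l - 1) / 2) ^ 2) •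
          logShell (PadicLogOnUnits.ofUnitLog 7 (kOf (pilotDataOfK T.D T.K) 7 x₀)) := by
  letI := T.instFieldF; letI := T.instNumberFieldF; letI := T.instAlgebraF; letI := T.instFieldK
  letI := T.instNumberFieldK; letI := T.instAlgebraK; letI := T.instFieldFbar; letI := T.instAlgebraFbar
  letI := T.instAlgebraKFbar; letI := T.instIsElliptic
  haveI : Fact (Nat.Prime 7) := ⟨by norm_num⟩
  have hk1 : 1 ≤ k := by
    rcases Nat.eq_zero_or_pos k with h0 | hpos
    · subst h0
      omega
    · exact hpos
  obtain ⟨x₀, hS, -, -, -, hnorm⟩ := GenuineK.exists_place_lamSeven hk1 hl h11 T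
  have he := GenuineK.absRamificationIdx_kOf_le_thirty_mul_lamSeven hk1 h11 T x₀
  exact ⟨x₀, hS, hnorm, i06star_topLabel_false_A1 hl (by omega) hl68 hk T x₀ hnorm he⟩

/-! ## 2. Numeric rows: every `k ≥ 2` at `l ∈ {11, 13}` -/

/-- **`l = 11`, MODEL-FREE: the top-label I06⋆ cell FAILS at every `λ_k` datum with `k ≥ 2`** (`16·11 = 176 ≤ 96·k`; p456127 had `k ≥ 6`
model-free). [claim: Mochizuki2012, status: disputed] -/
theorem i06star_topLabel_false_lamSeven_l11_two {k : ℕ} (hk : 2 ≤ k)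
    (T : Cor22.ThetaVolumeDatumAt (ratPoint ((2 : ℚ)⁻¹ + 2 / 7 ^ k)) 11) :
    letI := T.instFieldF; letI := T.instNumberFieldF; letI := T.instAlgebraF; letI := T.instFieldK
    letI := T.instNumberFieldK; letI := T.instAlgebraK; letI := T.instFieldFbar; letI := T.instAlgebraFbar
    letI := T.instAlgebraKFbar; letI := T.instIsElliptic
    haveI : Fact (Nat.Prime 7) := ⟨by norm_num⟩
    ∃ x₀ : (thetaIndex (pilotDataOfK T.D T.K)).Fibre (.inr ⟨7, by norm_num⟩),
      placeOf (pilotDataOfK T.D T.K) 7 x₀ ∈ (pilotDataOfK T.D T.K).S ∧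
      ‖(exists_realising_qIdeles_pilotDataOfK T.D).choose ⟨7, by norm_num⟩ x₀‖ = (7 : ℝ) ^ (-((k : ℝ) / (11 : ℕ))) ∧
      (exists_realising_qIdeles_pilotDataOfK T.D).choose ⟨7, by norm_num⟩ x₀ ∉
        (exists_realising_qIdeles_pilotDataOfK T.D).choose ⟨7, by norm_num⟩ x₀ ^ (((11 - 1) / 2) ^ 2) •
          logShell (PadicLogOnUnits.ofUnitLog 7 (kOf (pilotDataOfK T.D T.K) 7 x₀)) :=
  i06star_topLabel_false_lamSeven_thirty (by norm_num) le_rfl (by norm_num) (by show 16 * 11 ≤ k * 96; omega) T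

/-- **`l = 13`, MODEL-FREE: the top-label I06⋆ cell FAILS at every `λ_k` datum with `k ≥ 2`** (`16·13 = 208 ≤ 140·k`; p456127 had `k ≥ 5`
model-free). [claim: Mochizuki2012, status: disputed] -/
theorem i06star_topLabel_false_lamSeven_l13_two {k : ℕ} (hk : 2 ≤ k)
    (T : Cor22.ThetaVolumeDatumAt (ratPoint ((2 : ℚ)⁻¹ + 2 / 7 ^ k)) 13) :
    letI := T.instFieldF; letI := T.instNumberFieldF; letI := T.instAlgebraF; letI := T.instFieldK
    letI := T.instNumberFieldK; letI := T.instAlgebraK; letI := T.instFieldFbar; letI := T.instAlgebraFbar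
    letI := T.instAlgebraKFbar; letI := T.instIsElliptic
    haveI : Fact (Nat.Prime 7) := ⟨by norm_num⟩
    ∃ x₀ : (thetaIndex (pilotDataOfK T.D T.K)).Fibre (.inr ⟨7, by norm_num⟩),
      placeOf (pilotDataOfK T.D T.K) 7 x₀ ∈ (pilotDataOfK T.D T.K).S ∧
      ‖(exists_realising_qIdeles_pilotDataOfK T.D).choose ⟨7, by norm_num⟩ x₀‖ = (7 : ℝ) ^ (-((k : ℝ) / (13 : ℕ))) ∧
      (exists_realising_qIdeles_pilotDataOfK T.D).choose ⟨7, by norm_num⟩ x₀ ∉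
        (exists_realising_qIdeles_pilotDataOfK T.D).choose ⟨7, by norm_num⟩ x₀ ^ (((13 - 1) / 2) ^ 2) •
          logShell (PadicLogOnUnits.ofUnitLog 7 (kOf (pilotDataOfK T.D T.K) 7 x₀)) :=
  i06star_topLabel_false_lamSeven_thirty (by norm_num) (by norm_num) (by norm_num) (by show 16 * 13 ≤ k * 140; omega) T

end Summit.ABC.IUTFork.Repair.CandInternal2RealHex

end
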